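import Summits.HodgeConjecture.HodgeConjecture.Theorems.Ring2WeilCoverageNormClassEq
import Summits.HodgeConjecture.HodgeConjecture.Theorems.Ring2WeilNormObstructionDescentCensus
import HarnessLib

/-!
# Weil-type family coverage — THEOREM S6 (product-window law), part F: the `ℚ(√-2)` rows reached (`GL₂(3) × F₂₀`), the `ℚ(√-7)`
# fourteen-fold, the `W10.3.11` tenfold, and ring2-b06's two invited data — by the COSET engine

research route conditional on HC_CM; not a corollary; Q11.4-sentence-2 already refuted in dim ≥ 3.

Ring 2, WEIL-TYPE FAMILY-COVERAGE CENSUS (`## b04`, block b04.13 P.S. 6, owner ring2-b04, gen 49); sixth part of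
`Ring2WeilCoverageProductWindow` (same imports as part A).  Engine: `census-g49/bundle3/cosetwin.py` — the hidden factor `B = V^H`
computed on the COSET cover `Y = C̃/H` (`|G|/|H|` sheets; ring2-b06's b06.20 P.S. 2 idea, re-implemented on this seat's `qcover`-based
engine: the λ-block projector, the ρ-projector, the `K`-operator and the `G₂`-trace are CENTRAL in `ℚ[G]` and act on `H`-invariant
cochains; validated against the Galois-cover engine on `C₄ × S₃`, `C₃ × F₂₀`, `C₄ × AGL(1,7)`, `F₂₁ × S₃` data, same classes); the
literal determinants below are those of `Y`'s own cup form (class-equal to the Galois-cover ones for even `K`-rank).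
* `K = ℚ(√-2)` through `GL₂(3)` (`λ = χ₂`, `H₁` a non-central involution), `G₂ = F₂₀` (`n = 5` inert in `ℚ(√-2)`, law `[5]^{r₁}`):
  the rigid `(2,2)` FOURFOLD `(0; 2:22, 3:4A, 8a:4A)` (genus 141) on `W4.2.5` and the `(3,3)` SIXFOLDS on `W6.2.5 = (3, ℚ(√-2), [5])` —
  pub-hsemireg's R4 row for `ℚ(√-2)`, `a = 5` —: rigid `(0; 2:4A, 3:4A, 8a:22)` (genus 261) and the ONE-PARAMETER families
  `(0; 2:22, 2:22, 2:4A, 8a:4B)`, `(0; 2:22, 2:4A, 2:e, 8a:4A)` (genus 301); keys `[5]` / `[-5]` over ring2-b02's `five_not_mem_norm_two`.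
* `K = ℚ(√-7)` through `F₂₁`: the `(7,7)` fourteen-fold of the two-parameter `F₂₁ × S₃` family `(0; 3a:3, 3b:3, 7a:2, 7a:2, 7b:e)` (genus 130),
  class `[3]`, row `W14.7.3` (law `[3]^{r₁}`, `r₁ = 7`).
* `K = ℚ(√-3)`: the rigid `(5,5)` TENFOLD `C₃ × AGL(1,11)` `(0; c1:10A, c1:10A, c1:55A)` (genus 144) on `W10.3.11` (pre-registered in
  b04.13 P.S., computed first by ring2-b06 b06.20 P.S. 2, here ×2), and ring2-b06's two invited data: `C₃ × PGL₂(5)` `(0; c0:222, c1:4, c1:22, c1:33)`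
  (genus 166) on R1 = `W6.3.2` and `C₃ × A₅` `(0; c0:5A, c1:3, c1:3, c1:22)` (genus 88) on R2 = `W6.3.5` (their classes, ×2 here).
No `def`, no named fact, no `sorry`; nothing about Hodge classes; `HC_CM` used nowhere.  References: [cite: vanGeemen1994HodgeAV, (5.4.1), Lemma 5.2].
-/

set_option linter.dupNamespace false

open Literature.AlgebraicGeometry.Motives
open Literature.AlgebraicGeometry.VanGeemen1994
open Summit.HodgeConjecture.HodgeConjecture.Ring2.Hypotheses

namespace Summit.HodgeConjecture.HodgeConjecture.Ring2.WeilCoverage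

/-- `GL23xF20`-cover `(0; 2:22,3:4A,8a:4A)` (genus 141, Hurwitz dimension 0; engine `cosetwin.py` on the coset cover `C̃/H`, Y's own polarisation, exact): the HIDDEN FACTOR `B = V^{H₁×Stab(0)}` of the `(λ⊗ρ)`-piece `P ~ B^{0}` (census row of `P`: `None`) — an abelian FOURFOLD with `(2,2)` `ℚ(√-2)`-action, WEIL TYPE — has literal `det H|_B = 1/120`, `a = 1/120`, `T(a) = [2, 5]`: row `W4.2.5` (NON-split); `r₁ = dim_K H¹(C̃/G₂)_λ = 1`.
research route conditional on HC_CM; not a corollary; Q11.4-sentence-2 already refuted in dim ≥ 3. [cite: vanGeemen1994HodgeAV, (5.4.1)] -/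
theorem pwGL23F20_222_34A_8a4A_q0_g141_mk_detH_ne_split :
    (QuotientGroup.mk (Units.mk0 (((1 : ℚ) / 120)) (by norm_num)) : weilNormResidueGroup 2) ≠
      splitDiscriminantClass 2 2 := by
  have e : Units.mk0 (((1 : ℚ) / 120)) (by norm_num) = Units.mk0 ((1 : ℚ) / 120) (by norm_num) := Units.ext (by norm_num)
  rw [Ne, e, mk_eq_splitDiscriminantClass_iff_of_even (n := 2) (by decide)]
  have h := mul_not_mem_normUnitsSubgroup (mem_normUnitsSubgroup_of_sq_add_mul_sq (d := 2) (a := ((1 : ℚ) / 600)) (by norm_num) ((-1 : ℚ) / 30) ((1 : ℚ) / 60) (by norm_num))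
    Summit.HodgeConjecture.Ring2WeilNormDescent.five_not_mem_norm_two
  rw [mk0_mul_mk0] at h
  norm_num at h
  exact h

/-- The same datum, CELL IDENTIFICATION: `[det H|_B] = [5]` in `ℚˣ/Nm(ℚ(√-2)ˣ)` — the census ROW KEY of `W4.2.5` (`a·5 = ((1 : ℚ) / 24) = (((-1 : ℚ) / 6))² + 2·(((1 : ℚ) / 12))²`).
research route conditional on HC_CM; not a corollary; Q11.4-sentence-2 already refuted in dim ≥ 3. [cite: vanGeemen1994HodgeAV, Lemma 5.2 (3)] -/
theorem pwGL23F20_222_34A_8a4A_q0_g141_mk_detH_eq_key :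
    (QuotientGroup.mk (Units.mk0 (((1 : ℚ) / 120)) (by norm_num)) : weilNormResidueGroup 2) =
      QuotientGroup.mk (Units.mk0 (5 : ℚ) (by norm_num)) :=
  mk_eq_mk_of_mul_mem (by norm_num) (by norm_num)
    (mem_normUnitsSubgroup_of_sq_add_mul_sq _ ((-1 : ℚ) / 6) ((1 : ℚ) / 12) (by norm_num))

/-- `GL23xF20`-cover `(0; 2:4A,3:4A,8a:22)` (genus 261, Hurwitz dimension 0; engine `cosetwin.py` on the coset cover `C̃/H`, Y's own polarisation, exact): the HIDDEN FACTOR `B = V^{H₁×Stab(0)}` of the `(λ⊗ρ)`-piece `P ~ B^{0}` (census row of `P`: `None`) — an abelian SIXFOLD with `(3,3)` `ℚ(√-2)`-action, WEIL TYPE — has literal `det H|_B = -1/25920`, `a = 1/25920`, `T(a) = [2, 5]`: row `W6.2.5` (NON-split); `r₁ = dim_K H¹(C̃/G₂)_λ = 1`.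
research route conditional on HC_CM; not a corollary; Q11.4-sentence-2 already refuted in dim ≥ 3. [cite: vanGeemen1994HodgeAV, (5.4.1)] -/
theorem pwGL23F20_24A_34A_8a22_q0_g261_mk_detH_ne_split :
    (QuotientGroup.mk (Units.mk0 (((-1 : ℚ) / 25920)) (by norm_num)) : weilNormResidueGroup 2) ≠
      splitDiscriminantClass 3 2 := by
  have e : Units.mk0 (((-1 : ℚ) / 25920)) (by norm_num) = -(Units.mk0 ((1 : ℚ) / 25920) (by norm_num)) := Units.ext (by norm_num)
  rw [Ne, e, mk_neg_eq_splitDiscriminantClass_iff_of_odd (n := 3) (by decide)]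
  have h := mul_not_mem_normUnitsSubgroup (mem_normUnitsSubgroup_of_sq_add_mul_sq (d := 2) (a := ((1 : ℚ) / 129600)) (by norm_num) ((1 : ℚ) / 360) (0 : ℚ) (by norm_num))
    Summit.HodgeConjecture.Ring2WeilNormDescent.five_not_mem_norm_two
  rw [mk0_mul_mk0] at h
  norm_num at h
  exact h

/-- The same datum, CELL IDENTIFICATION: `[det H|_B] = [-5]` in `ℚˣ/Nm(ℚ(√-2)ˣ)` — the census ROW KEY of `W6.2.5` (`a·5 = ((1 : ℚ) / 5184) = (((1 : ℚ) / 72))² + 2·((0 : ℚ))²`).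
research route conditional on HC_CM; not a corollary; Q11.4-sentence-2 already refuted in dim ≥ 3. [cite: vanGeemen1994HodgeAV, Lemma 5.2 (3)] -/
theorem pwGL23F20_24A_34A_8a22_q0_g261_mk_detH_eq_key :
    (QuotientGroup.mk (Units.mk0 (-(((1 : ℚ) / 25920))) (neg_ne_zero.2 (by norm_num))) : weilNormResidueGroup 2) =
      QuotientGroup.mk (Units.mk0 (-(5 : ℚ)) (neg_ne_zero.2 (by norm_num))) :=
  mk_neg_eq_mk_neg_of_mul_mem (by norm_num) (by norm_num)
    (mem_normUnitsSubgroup_of_sq_add_mul_sq _ ((1 : ℚ) / 72) (0 : ℚ) (by norm_num))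

/-- `GL23xF20`-cover `(0; 2:22,2:22,2:4A,8a:4B)` (genus 301, Hurwitz dimension 1; engine `cosetwin.py` on the coset cover `C̃/H`, Y's own polarisation, exact): the HIDDEN FACTOR `B = V^{H₁×Stab(0)}` of the `(λ⊗ρ)`-piece `P ~ B^{0}` (census row of `P`: `None`) — an abelian SIXFOLD with `(3,3)` `ℚ(√-2)`-action, WEIL TYPE — has literal `det H|_B = -1/6480`, `a = 1/6480`, `T(a) = [2, 5]`: row `W6.2.5` (NON-split); `r₁ = dim_K H¹(C̃/G₂)_λ = 1`.
research route conditional on HC_CM; not a corollary; Q11.4-sentence-2 already refuted in dim ≥ 3. [cite: vanGeemen1994HodgeAV, (5.4.1)] -/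
theorem pwGL23F20_222_222_24A_8a4B_q0_g301_mk_detH_ne_split :
    (QuotientGroup.mk (Units.mk0 (((-1 : ℚ) / 6480)) (by norm_num)) : weilNormResidueGroup 2) ≠
      splitDiscriminantClass 3 2 := by
  have e : Units.mk0 (((-1 : ℚ) / 6480)) (by norm_num) = -(Units.mk0 ((1 : ℚ) / 6480) (by norm_num)) := Units.ext (by norm_num)
  rw [Ne, e, mk_neg_eq_splitDiscriminantClass_iff_of_odd (n := 3) (by decide)]
  have h := mul_not_mem_normUnitsSubgroup (mem_normUnitsSubgroup_of_sq_add_mul_sq (d := 2) (a := ((1 : ℚ) / 32400)) (by norm_num) ((1 : ℚ) / 180) (0 : ℚ) (by norm_num))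
    Summit.HodgeConjecture.Ring2WeilNormDescent.five_not_mem_norm_two
  rw [mk0_mul_mk0] at h
  norm_num at h
  exact h

/-- The same datum, CELL IDENTIFICATION: `[det H|_B] = [-5]` in `ℚˣ/Nm(ℚ(√-2)ˣ)` — the census ROW KEY of `W6.2.5` (`a·5 = ((1 : ℚ) / 1296) = (((1 : ℚ) / 36))² + 2·((0 : ℚ))²`).
research route conditional on HC_CM; not a corollary; Q11.4-sentence-2 already refuted in dim ≥ 3. [cite: vanGeemen1994HodgeAV, Lemma 5.2 (3)] -/
theorem pwGL23F20_222_222_24A_8a4B_q0_g301_mk_detH_eq_key :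
    (QuotientGroup.mk (Units.mk0 (-(((1 : ℚ) / 6480))) (neg_ne_zero.2 (by norm_num))) : weilNormResidueGroup 2) =
      QuotientGroup.mk (Units.mk0 (-(5 : ℚ)) (neg_ne_zero.2 (by norm_num))) :=
  mk_neg_eq_mk_neg_of_mul_mem (by norm_num) (by norm_num)
    (mem_normUnitsSubgroup_of_sq_add_mul_sq _ ((1 : ℚ) / 36) (0 : ℚ) (by norm_num))

/-- `GL23xF20`-cover `(0; 2:22,2:4A,2:e,8a:4A)` (genus 301, Hurwitz dimension 1; engine `cosetwin.py` on the coset cover `C̃/H`, Y's own polarisation, exact): the HIDDEN FACTOR `B = V^{H₁×Stab(0)}` of the `(λ⊗ρ)`-piece `P ~ B^{0}` (census row of `P`: `None`) — an abelian SIXFOLD with `(3,3)` `ℚ(√-2)`-action, WEIL TYPE — has literal `det H|_B = -1/3240`, `a = 1/3240`, `T(a) = [2, 5]`: row `W6.2.5` (NON-split); `r₁ = dim_K H¹(C̃/G₂)_λ = 1`.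
research route conditional on HC_CM; not a corollary; Q11.4-sentence-2 already refuted in dim ≥ 3. [cite: vanGeemen1994HodgeAV, (5.4.1)] -/
theorem pwGL23F20_222_24A_2e_8a4A_q0_g301_mk_detH_ne_split :
    (QuotientGroup.mk (Units.mk0 (((-1 : ℚ) / 3240)) (by norm_num)) : weilNormResidueGroup 2) ≠
      splitDiscriminantClass 3 2 := by
  have e : Units.mk0 (((-1 : ℚ) / 3240)) (by norm_num) = -(Units.mk0 ((1 : ℚ) / 3240) (by norm_num)) := Units.ext (by norm_num)
  rw [Ne, e, mk_neg_eq_splitDiscriminantClass_iff_of_odd (n := 3) (by decide)]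
  have h := mul_not_mem_normUnitsSubgroup (mem_normUnitsSubgroup_of_sq_add_mul_sq (d := 2) (a := ((1 : ℚ) / 16200)) (by norm_num) (0 : ℚ) ((1 : ℚ) / 180) (by norm_num))
    Summit.HodgeConjecture.Ring2WeilNormDescent.five_not_mem_norm_two
  rw [mk0_mul_mk0] at h
  norm_num at h
  exact h

/-- The same datum, CELL IDENTIFICATION: `[det H|_B] = [-5]` in `ℚˣ/Nm(ℚ(√-2)ˣ)` — the census ROW KEY of `W6.2.5` (`a·5 = ((1 : ℚ) / 648) = ((0 : ℚ))² + 2·(((1 : ℚ) / 36))²`).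
research route conditional on HC_CM; not a corollary; Q11.4-sentence-2 already refuted in dim ≥ 3. [cite: vanGeemen1994HodgeAV, Lemma 5.2 (3)] -/
theorem pwGL23F20_222_24A_2e_8a4A_q0_g301_mk_detH_eq_key :
    (QuotientGroup.mk (Units.mk0 (-(((1 : ℚ) / 3240))) (neg_ne_zero.2 (by norm_num))) : weilNormResidueGroup 2) =
      QuotientGroup.mk (Units.mk0 (-(5 : ℚ)) (neg_ne_zero.2 (by norm_num))) :=
  mk_neg_eq_mk_neg_of_mul_mem (by norm_num) (by norm_num)
    (mem_normUnitsSubgroup_of_sq_add_mul_sq _ (0 : ℚ) ((1 : ℚ) / 36) (by norm_num))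

/-- `F₂₁ × S₃`-cover `(0; 3a:3,3b:3,7a:2,7a:2,7b:e)` (genus 130, Hurwitz dimension 2; engine `cosetwin.py` on the coset cover `C̃/H`, Y's own polarisation, exact): the HIDDEN FACTOR `B = V^{H₁×Stab(0)}` of the `(λ⊗ρ)`-piece `P ~ B^{0}` (census row of `P`: `None`) — an abelian dim-7 with `(7,7)` `ℚ(√-7)`-action, WEIL TYPE — has literal `det H|_B = -32768/1701`, `a = 32768/1701`, `T(a) = [3, 7]`: row `W14.7.3` (NON-split); `r₁ = dim_K H¹(C̃/G₂)_λ = 7`.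
research route conditional on HC_CM; not a corollary; Q11.4-sentence-2 already refuted in dim ≥ 3. [cite: vanGeemen1994HodgeAV, (5.4.1)] -/
theorem pwF21S3_3a3_3b3_7a2_7a2_7be_q0_g130_mk_detH_ne_split :
    (QuotientGroup.mk (Units.mk0 (((-32768 : ℚ) / 1701)) (by norm_num)) : weilNormResidueGroup 7) ≠
      splitDiscriminantClass 7 7 := by
  have e : Units.mk0 (((-32768 : ℚ) / 1701)) (by norm_num) = -(Units.mk0 ((32768 : ℚ) / 1701) (by norm_num)) := Units.ext (by norm_num)
  rw [Ne, e, mk_neg_eq_splitDiscriminantClass_iff_of_odd (n := 7) (by decide)]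
  have h := mul_not_mem_normUnitsSubgroup (mem_normUnitsSubgroup_of_sq_add_mul_sq (d := 7) (a := ((32768 : ℚ) / 5103)) (by norm_num) ((-64 : ℚ) / 27) ((64 : ℚ) / 189) (by norm_num))
    Summit.HodgeConjecture.Ring2WeilNormDescent.three_not_mem_norm_seven
  rw [mk0_mul_mk0] at h
  norm_num at h
  exact h

/-- The same datum, CELL IDENTIFICATION: `[det H|_B] = [-3]` in `ℚˣ/Nm(ℚ(√-7)ˣ)` — the census ROW KEY of `W14.7.3` (`a·3 = ((32768 : ℚ) / 567) = (((-64 : ℚ) / 9))² + 7·(((64 : ℚ) / 63))²`).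
research route conditional on HC_CM; not a corollary; Q11.4-sentence-2 already refuted in dim ≥ 3. [cite: vanGeemen1994HodgeAV, Lemma 5.2 (3)] -/
theorem pwF21S3_3a3_3b3_7a2_7a2_7be_q0_g130_mk_detH_eq_key :
    (QuotientGroup.mk (Units.mk0 (-(((32768 : ℚ) / 1701))) (neg_ne_zero.2 (by norm_num))) : weilNormResidueGroup 7) =
      QuotientGroup.mk (Units.mk0 (-(3 : ℚ)) (neg_ne_zero.2 (by norm_num))) :=
  mk_neg_eq_mk_neg_of_mul_mem (by norm_num) (by norm_num)
    (mem_normUnitsSubgroup_of_sq_add_mul_sq _ ((-64 : ℚ) / 9) ((64 : ℚ) / 63) (by norm_num))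

/-- `C3xPGL25`-cover `(0; c0:222,c1:4,c1:22,c1:33)` (genus 166, Hurwitz dimension 1; engine `cosetwin.py` on the coset cover `C̃/H`, Y's own polarisation, exact): the HIDDEN FACTOR `B = V^{H₁×Stab(0)}` of the `(λ⊗ρ)`-piece `P ~ B^{0}` (census row of `P`: `None`) — an abelian SIXFOLD with `(3,3)` `ℚ(√-3)`-action, WEIL TYPE — has literal `det H|_B = -32/9`, `a = 32/9`, `T(a) = [2, 3]`: row `W6.3.2` (NON-split); `r₁ = dim_K H¹(C̃/G₂)_λ = 1`. THEOREM S6 (product-window law, census b04.13 (A)) predicts `T(a_B) = [2, 3]` from `r₁ = 1`, `r_H = 7` — CONFIRMED.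
research route conditional on HC_CM; not a corollary; Q11.4-sentence-2 already refuted in dim ≥ 3. [cite: vanGeemen1994HodgeAV, (5.4.1)] -/
theorem pwC3PGL25_c0222_c14_c122_c133_q0_g166_mk_detH_ne_split :
    (QuotientGroup.mk (Units.mk0 (((-32 : ℚ) / 9)) (by norm_num)) : weilNormResidueGroup 3) ≠
      splitDiscriminantClass 3 3 := by
  have e : Units.mk0 (((-32 : ℚ) / 9)) (by norm_num) = -(Units.mk0 ((32 : ℚ) / 9) (by norm_num)) := Units.ext (by norm_num)
  rw [Ne, e, mk_neg_eq_splitDiscriminantClass_iff_of_odd (n := 3) (by decide)]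
  have h := mul_not_mem_normUnitsSubgroup (mem_normUnitsSubgroup_of_sq_add_mul_sq (d := 3) (a := ((16 : ℚ) / 9)) (by norm_num) ((4 : ℚ) / 3) (0 : ℚ) (by norm_num))
    Summit.HodgeConjecture.Ring2WeilNormDescent.two_not_mem_norm_three
  rw [mk0_mul_mk0] at h
  norm_num at h
  exact h

/-- The same datum, CELL IDENTIFICATION: `[det H|_B] = [-2]` in `ℚˣ/Nm(ℚ(√-3)ˣ)` — the census ROW KEY of `W6.3.2` (`a·2 = ((64 : ℚ) / 9) = (((8 : ℚ) / 3))² + 3·((0 : ℚ))²`).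
research route conditional on HC_CM; not a corollary; Q11.4-sentence-2 already refuted in dim ≥ 3. [cite: vanGeemen1994HodgeAV, Lemma 5.2 (3)] -/
theorem pwC3PGL25_c0222_c14_c122_c133_q0_g166_mk_detH_eq_key :
    (QuotientGroup.mk (Units.mk0 (-(((32 : ℚ) / 9))) (neg_ne_zero.2 (by norm_num))) : weilNormResidueGroup 3) =
      QuotientGroup.mk (Units.mk0 (-(2 : ℚ)) (neg_ne_zero.2 (by norm_num))) :=
  mk_neg_eq_mk_neg_of_mul_mem (by norm_num) (by norm_num)
    (mem_normUnitsSubgroup_of_sq_add_mul_sq _ ((8 : ℚ) / 3) (0 : ℚ) (by norm_num))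

/-- `C₃ × A₅` (on 5 points)-cover `(0; c0:5A,c1:3,c1:3,c1:22)` (genus 88, Hurwitz dimension 1; engine `cosetwin.py` on the coset cover `C̃/H`, Y's own polarisation, exact): the HIDDEN FACTOR `B = V^{H₁×Stab(0)}` of the `(λ⊗ρ)`-piece `P ~ B^{0}` (census row of `P`: `None`) — an abelian SIXFOLD with `(3,3)` `ℚ(√-3)`-action, WEIL TYPE — has literal `det H|_B = -64/15`, `a = 64/15`, `T(a) = [3, 5]`: row `W6.3.5` (NON-split); `r₁ = dim_K H¹(C̃/G₂)_λ = 1`. THEOREM S6 (product-window law, census b04.13 (A)) predicts `T(a_B) = [3, 5]` from `r₁ = 1`, `r_H = 7` — CONFIRMED.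
research route conditional on HC_CM; not a corollary; Q11.4-sentence-2 already refuted in dim ≥ 3. [cite: vanGeemen1994HodgeAV, (5.4.1)] -/
theorem pwC3A5_c05A_c13_c13_c122_q0_g88_mk_detH_ne_split :
    (QuotientGroup.mk (Units.mk0 (((-64 : ℚ) / 15)) (by norm_num)) : weilNormResidueGroup 3) ≠
      splitDiscriminantClass 3 3 := by
  have e : Units.mk0 (((-64 : ℚ) / 15)) (by norm_num) = -(Units.mk0 ((64 : ℚ) / 15) (by norm_num)) := Units.ext (by norm_num)
  rw [Ne, e, mk_neg_eq_splitDiscriminantClass_iff_of_odd (n := 3) (by decide)]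
  have h := mul_not_mem_normUnitsSubgroup (mem_normUnitsSubgroup_of_sq_add_mul_sq (d := 3) (a := ((64 : ℚ) / 75)) (by norm_num) (0 : ℚ) ((8 : ℚ) / 15) (by norm_num))
    Summit.HodgeConjecture.Ring2WeilNormDescent.five_not_mem_norm_three
  rw [mk0_mul_mk0] at h
  norm_num at h
  exact h

/-- The same datum, CELL IDENTIFICATION: `[det H|_B] = [-5]` in `ℚˣ/Nm(ℚ(√-3)ˣ)` — the census ROW KEY of `W6.3.5` (`a·5 = ((64 : ℚ) / 3) = ((0 : ℚ))² + 3·(((8 : ℚ) / 3))²`).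
research route conditional on HC_CM; not a corollary; Q11.4-sentence-2 already refuted in dim ≥ 3. [cite: vanGeemen1994HodgeAV, Lemma 5.2 (3)] -/
theorem pwC3A5_c05A_c13_c13_c122_q0_g88_mk_detH_eq_key :
    (QuotientGroup.mk (Units.mk0 (-(((64 : ℚ) / 15))) (neg_ne_zero.2 (by norm_num))) : weilNormResidueGroup 3) =
      QuotientGroup.mk (Units.mk0 (-(5 : ℚ)) (neg_ne_zero.2 (by norm_num))) :=
  mk_neg_eq_mk_neg_of_mul_mem (by norm_num) (by norm_num)
    (mem_normUnitsSubgroup_of_sq_add_mul_sq _ (0 : ℚ) ((8 : ℚ) / 3) (by norm_num))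

/-- `C₃ × AGL(1,11)`-cover `(0; c1:10A,c1:10A,c1:55A)` (genus 144, Hurwitz dimension 0; engine `cosetwin.py` on the coset cover `C̃/H`, Y's own polarisation, exact): the HIDDEN FACTOR `B = V^{H₁×Stab(0)}` of the `(λ⊗ρ)`-piece `P ~ B^{0}` (census row of `P`: `None`) — an abelian TENFOLD with `(5,5)` `ℚ(√-3)`-action, WEIL TYPE — has literal `det H|_B = -1024/297`, `a = 1024/297`, `T(a) = [3, 11]`: row `W10.3.11` (NON-split); `r₁ = dim_K H¹(C̃/G₂)_λ = 1`. THEOREM S6 (product-window law, census b04.13 (A)) predicts `T(a_B) = [3, 11]` from `r₁ = 1`, `r_H = 11` — CONFIRMED.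
research route conditional on HC_CM; not a corollary; Q11.4-sentence-2 already refuted in dim ≥ 3. [cite: vanGeemen1994HodgeAV, (5.4.1)] -/
theorem pwC3AGL111_c110A_c110A_c155A_q0_g144_mk_detH_ne_split :
    (QuotientGroup.mk (Units.mk0 (((-1024 : ℚ) / 297)) (by norm_num)) : weilNormResidueGroup 3) ≠
      splitDiscriminantClass 5 3 := by
  have e : Units.mk0 (((-1024 : ℚ) / 297)) (by norm_num) = -(Units.mk0 ((1024 : ℚ) / 297) (by norm_num)) := Units.ext (by norm_num)
  rw [Ne, e, mk_neg_eq_splitDiscriminantClass_iff_of_odd (n := 5) (by decide)]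
  have h := mul_not_mem_normUnitsSubgroup (mem_normUnitsSubgroup_of_sq_add_mul_sq (d := 3) (a := ((1024 : ℚ) / 3267)) (by norm_num) (0 : ℚ) ((32 : ℚ) / 99) (by norm_num))
    Summit.HodgeConjecture.Ring2WeilNormDescent.eleven_not_mem_norm_three
  rw [mk0_mul_mk0] at h
  norm_num at h
  exact h

/-- The same datum, CELL IDENTIFICATION: `[det H|_B] = [-11]` in `ℚˣ/Nm(ℚ(√-3)ˣ)` — the census ROW KEY of `W10.3.11` (`a·11 = ((1024 : ℚ) / 27) = ((0 : ℚ))² + 3·(((32 : ℚ) / 9))²`).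
research route conditional on HC_CM; not a corollary; Q11.4-sentence-2 already refuted in dim ≥ 3. [cite: vanGeemen1994HodgeAV, Lemma 5.2 (3)] -/
theorem pwC3AGL111_c110A_c110A_c155A_q0_g144_mk_detH_eq_key :
    (QuotientGroup.mk (Units.mk0 (-(((1024 : ℚ) / 297))) (neg_ne_zero.2 (by norm_num))) : weilNormResidueGroup 3) =
      QuotientGroup.mk (Units.mk0 (-(11 : ℚ)) (neg_ne_zero.2 (by norm_num))) :=
  mk_neg_eq_mk_neg_of_mul_mem (by norm_num) (by norm_num)
    (mem_normUnitsSubgroup_of_sq_add_mul_sq _ (0 : ℚ) ((32 : ℚ) / 9) (by norm_num))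

end Summit.HodgeConjecture.HodgeConjecture.Ring2.WeilCoverage
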